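import Mathlib
import Literature.Barriers.PneNP.CorrelationPolytopeXCLowerBoundGraph
import Literature.Barriers.PneNP.ExtendedFormulationMinkowskiFaces
import Literature.Barriers.PneNP.ExtendedFormulationLinearImage
import Summits.ValiantsHypothesis.ValiantsHypothesis.Theorems.FifoMatchingXcDivisionZmixFace
import Summits.ValiantsHypothesis.ValiantsHypothesis.Theorems.FifoMatchingXcDivisionChamberCertificate
import Summits.ValiantsHypothesis.ValiantsHypothesis.Theorems.FifoMatchingNNDivisionHardLowDimFace
import HarnessLib

/-!
# ★ The EXPOSURE RUNG for `COR(n) + Q` (val-idea-40's `DimensionRung.lean` §3; class D of line `virtual_passenger`,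
# crux `Theses.FifoMatching.NNDivisionHard`, stmt-ValiantsHypothesis-21181)

Theorems-side port (port hand val-port-1 g3; desk RULING #331 «LowDim PORT»; `--supports stmt-ValiantsHypothesis-21181 --as helper`) of
`Cruxes/NNDivisionHard/DimensionRung.lean` (rev 4 @a45b7939cb12, val-idea-40 g0, sha16 e492007789666bf5; critic of record val-idea-crit-9 g0)
§3, proof text VERBATIM over `…LowDimDefs` / `…LowDimFace` (test functionals `psi`, FMPTW data `ud_data`, `diagDir`), ✓ `…XcDivisionChamberCertificate`
(`three_pow_le_of_add`, the chamber pigeonhole) and ✓ `…XcDivisionZmixFace` (`dot_le_of_mem_convexHull`, `mem_convexHull_maximisers`); the line's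
`hasEFOfSize_face_add` is CITED as val-lit-p10's `HasEFOfSize.face_add_face₁` (same statement, `Literature/…/ExtendedFormulationMinkowskiFaces.lean`).

CONTENT: ★ **EXPOSURE RUNG** `corPolytope_add_genericFace_three_pow_le`: if `COR(n) + Q` has an extended formulation of size `r`, `Q = conv{q j}`,
`S, S'` are disjoint with `m` indices outside both, and NO TWO DISTINCT generators differ by a solution of the face equations of `F_{S,S'}`, then
`3^m ≤ (r + 1)·2^m`: ONE generic functional `M·(E_S − E_{S'}) + Σ_t ε_t ψ_t` in the normal cone of `F_{S,S'}` exposes `F_{S,S'} + {q_{j₀}}`, and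
FMPTW/Kaibel–Weltge applies to the face.  The FLAG LEMMA / ★ DIMENSION RUNG are the sibling `…LowDimRung.lean`.

HONEST FRAMING: a certificate for a class of passengers (restriction of COR-MINKOWSKI / COR-VIRTUAL); stmt-21181 `NNDivisionHard` OPEN;
`VP ≠ VNP` NOT proved; nothing here is a summit statement.
-/

set_option autoImplicit false

-- the mandated summit-side namespace repeats a component by design (single-problem summit)
set_option linter.dupNamespace false

noncomputable section

open Matrix Finset
open scoped Pointwise

namespace Summit.ValiantsHypothesis.ValiantsHypothesis.Theorems.FifoMatching

namespace LowDim

open Literature.Barriers.PneNP (HasEFOfSize)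
open Literature.Combinatorics.Optimization (corPolytopeGraph)
open Literature.Combinatorics.Optimization.FixedSizePsdRank (Cube vecOuter bvec corPolytope flat
  flat_dotProduct_vecOuter)
open Summit.ValiantsHypothesis.ValiantsHypothesis.Theorems.FifoMatching.XcDivision

variable {n : ℕ}

/-! ## §3 The EXPOSURE RUNG -/

/-- ★ **EXPOSURE RUNG.**  If `COR(n) + Q` has an extended formulation of size `r`, `Q = conv{q j}` (up to the usual
sandwich), `S, S'` are disjoint with `m` indices `e` outside both, and NO TWO DISTINCT generators `q j ≠ q j'` differ
by a vector annihilated by every test functional of the face `F_{S,S'}` (i.e. by a solution of the face's linear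
equations), then `3^m ≤ (r + 1) · 2^m`: a generic functional `M·(E_S - E_{S'}) + Σ_t ε_t ψ_t` in the normal cone of
`F_{S,S'}` exposes `F_{S,S'} + {q_{j₀}}`, and FMPTW/Kaibel–Weltge applies to the face (PROP B with ONE maximiser, for
every passenger transversal to the face). -/
theorem corPolytope_add_genericFace_three_pow_le {n m r : ℕ} {Q : Set (Fin (n * n) → ℝ)}
    (h : HasEFOfSize (corPolytope n + Q) r) {J : Type} [Fintype J] [Nonempty J] [DecidableEq J]
    (q : J → (Fin (n * n) → ℝ)) (hq : ∀ j, q j ∈ Q) (hQ : Q ⊆ convexHull ℝ (Set.range q))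
    (S S' : Finset (Fin n)) (hSS' : Disjoint S S') (e : Fin m ↪ Fin n) (heS : ∀ i, e i ∉ S)
    (heS' : ∀ i, e i ∉ S')
    (hsep : ∀ j j', (∀ t, psi S S' t ⬝ᵥ (q j - q j') = 0) → q j = q j') :
    3 ^ m ≤ (r + 1) * 2 ^ m := by
  classical
  obtain ⟨pt_mem, cc_valid, slack, diag_pt⟩ := ud_data n
  -- (1) a generic combination of the tests
  let BAD : Finset (J × J) := Finset.univ.filter fun jj => q jj.1 ≠ q jj.2
  obtain ⟨ε, hε⟩ := exists_generic_comb (K := Bool × Fin n × Fin n) BAD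
    (fun t (jj : J × J) => psi S S' t ⬝ᵥ (q jj.1 - q jj.2))
  let ev : Fin (n * n) → ℝ := ∑ t, ε t • psi S S' t
  have hev : ∀ x, ev ⬝ᵥ x = ∑ t, ε t * (psi S S' t ⬝ᵥ x) := by
    intro x
    simp only [ev, sum_dotProduct, smul_dotProduct, smul_eq_mul]
  -- (2) the dominant diagonal part, avoiding the remaining coincidences
  have hpairs : ∀ p ∈ BAD.image (fun jj => (diagDir S S' ⬝ᵥ (q jj.1 - q jj.2), ev ⬝ᵥ (q jj.1 - q jj.2))),
      p.1 ≠ 0 ∨ p.2 ≠ 0 := by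
    intro p hp
    obtain ⟨jj, hjj, rfl⟩ := Finset.mem_image.1 hp
    by_contra hcon
    push Not at hcon
    have hbad : q jj.1 ≠ q jj.2 := (Finset.mem_filter.1 hjj).2
    apply hbad
    apply hsep
    intro t
    by_contra ht
    have hne := hε jj hjj ⟨t, ht⟩
    rw [← hev] at hne
    exact hne hcon.2
  obtain ⟨M, hMC, hM⟩ := exists_large_avoid _ hpairs (2 * ∑ t, |ε t|)
  set w : Fin (n * n) → ℝ := M • diagDir S S' + ev with hw
  have hwdot : ∀ x, w ⬝ᵥ x = M * (diagDir S S' ⬝ᵥ x) + ev ⬝ᵥ x := by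
    intro x; rw [hw, add_dotProduct, smul_dotProduct, smul_eq_mul]
  -- `w` separates distinct generators
  have hwsep : ∀ j j', q j ≠ q j' → w ⬝ᵥ q j ≠ w ⬝ᵥ q j' := by
    intro j j' hne heq
    have hmem : (diagDir S S' ⬝ᵥ (q j - q j'), ev ⬝ᵥ (q j - q j')) ∈
        BAD.image (fun jj => (diagDir S S' ⬝ᵥ (q jj.1 - q jj.2), ev ⬝ᵥ (q jj.1 - q jj.2))) :=
      Finset.mem_image.2 ⟨(j, j'), Finset.mem_filter.2 ⟨Finset.mem_univ _, hne⟩, rfl⟩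
    have hne' := hM _ hmem
    apply hne'
    show diagDir S S' ⬝ᵥ (q j - q j') * M + ev ⬝ᵥ (q j - q j') = 0
    have h1 : w ⬝ᵥ (q j - q j') = 0 := by rw [dotProduct_sub, heq, sub_self]
    rw [hwdot] at h1
    linarith
  -- (3) values on the vertices of `COR(n)`
  have hdiag : ∀ b : Finset (Fin n),
      diagDir S S' ⬝ᵥ udPt b = ((S ∩ b).card : ℝ) - ((S' ∩ b).card : ℝ) := by
    intro b
    rw [diagDir, diag_pt]
    have hσ : ∀ i, (if i ∈ S then (1 : ℝ) else if i ∈ S' then -1 else 0) =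
        (if i ∈ S then (1 : ℝ) else 0) - (if i ∈ S' then 1 else 0) := by
      intro i
      by_cases h1 : i ∈ S
      · have h2 : i ∉ S' := Finset.disjoint_left.1 hSS' h1
        simp [h1, h2]
      · by_cases h2 : i ∈ S' <;> simp [h1, h2]
    simp_rw [hσ]
    rw [Finset.sum_sub_distrib, Finset.sum_boole, Finset.sum_boole, Finset.filter_mem_eq_inter,
      Finset.filter_mem_eq_inter, Finset.inter_comm b S, Finset.inter_comm b S']
  have hdiag_face : ∀ b : Finset (Fin n), S ⊆ b → Disjoint S' b →
      diagDir S S' ⬝ᵥ udPt b = S.card := by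
    intro b hSb hS'b
    rw [hdiag b, Finset.inter_eq_left.2 hSb, Finset.disjoint_iff_inter_eq_empty.1 hS'b,
      Finset.card_empty]
    simp
  have hdiag_off : ∀ b : Finset (Fin n), ¬ (S ⊆ b ∧ Disjoint S' b) →
      diagDir S S' ⬝ᵥ udPt b ≤ S.card - 1 := by
    intro b hb
    rw [hdiag b]
    by_cases hSb : S ⊆ b
    · have hS'b : ¬ Disjoint S' b := fun h' => hb ⟨hSb, h'⟩
      obtain ⟨i, hi⟩ := Finset.not_disjoint_iff_nonempty_inter.1 hS'b
      have h2 : (1 : ℝ) ≤ (S' ∩ b).card := by exact_mod_cast Finset.card_pos.2 ⟨i, hi⟩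
      have h1 : ((S ∩ b).card : ℝ) ≤ S.card := by
        exact_mod_cast Finset.card_le_card Finset.inter_subset_left
      linarith
    · have hlt : (S ∩ b).card < S.card := by
        apply Finset.card_lt_card
        refine ⟨Finset.inter_subset_left, fun hsub => hSb ?_⟩
        exact fun i hi => (Finset.mem_inter.1 (hsub hi)).2
      have h1 : ((S ∩ b).card : ℝ) + 1 ≤ S.card := by exact_mod_cast hlt
      have h2 : (0 : ℝ) ≤ (S' ∩ b).card := by positivity
      linarith
  have hev_le : ∀ b : Finset (Fin n), |ev ⬝ᵥ udPt b| ≤ ∑ t, |ε t| := by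
    intro b
    rw [hev]
    refine (Finset.abs_sum_le_sum_abs _ _).trans ?_
    refine Finset.sum_le_sum fun t _ => ?_
    rw [abs_mul]
    exact mul_le_of_le_one_right (abs_nonneg _) (psi_abs_le S S' t b)
  have hev_face : ∀ b : Finset (Fin n), S ⊆ b → Disjoint S' b → ev ⬝ᵥ udPt b = ev ⬝ᵥ udPt S := by
    intro b hSb hS'b
    rw [hev, hev]
    exact Finset.sum_congr rfl fun t _ => by rw [psi_face S S' hSS' t b hSb hS'b]
  set δP : ℝ := M * S.card + ev ⬝ᵥ udPt S with hδP
  have hMpos : 0 ≤ M := by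
    have : (0 : ℝ) ≤ 2 * ∑ t, |ε t| := by positivity
    linarith
  have hw_vert : ∀ b : Finset (Fin n), w ⬝ᵥ udPt b ≤ δP := by
    intro b
    rw [hwdot]
    by_cases hb : S ⊆ b ∧ Disjoint S' b
    · rw [hdiag_face b hb.1 hb.2, hev_face b hb.1 hb.2]
    · have h1 := hdiag_off b hb
      have h2 := hev_le b
      have h3 := hev_le S
      rw [abs_le] at h2 h3
      have h4 : M * (diagDir S S' ⬝ᵥ udPt b) ≤ M * ((S.card : ℝ) - 1) :=
        mul_le_mul_of_nonneg_left h1 hMpos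
      linarith [h2.2, h3.1]
  have hw_face : ∀ b : Finset (Fin n), S ⊆ b → Disjoint S' b → w ⬝ᵥ udPt b = δP := by
    intro b hSb hS'b
    rw [hwdot, hdiag_face b hSb hS'b, hev_face b hSb hS'b]
  -- validity of `w` on `COR(n)`
  have hgen : ∀ y ∈ Set.range (fun a : Cube n => vecOuter n (bvec a)), w ⬝ᵥ y ≤ δP := by
    rintro _ ⟨a, rfl⟩
    have hpt : vecOuter n (bvec a) = udPt (Finset.univ.filter fun i => a i = true) := by
      unfold udPt
      congr 1
      funext i
      rw [udInd_apply]
      simp [bvec]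
    show w ⬝ᵥ vecOuter n (bvec a) ≤ δP
    rw [hpt]
    exact hw_vert _
  have hwP : ∀ x ∈ corPolytope n, w ⬝ᵥ x ≤ δP := fun x hx =>
    dot_le_of_mem_convexHull _ w δP hgen x hx
  -- (4) the face of `Q`: a single point
  obtain ⟨j₀, -, hj₀⟩ :=
    Finset.exists_max_image Finset.univ (fun j => w ⬝ᵥ q j) Finset.univ_nonempty
  have hmax : ∀ j, w ⬝ᵥ q j ≤ w ⬝ᵥ q j₀ := fun j => hj₀ j (Finset.mem_univ j)
  set δQ := w ⬝ᵥ q j₀ with hδQ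
  have hwQ : ∀ y ∈ Q, w ⬝ᵥ y ≤ δQ := fun y hy =>
    dot_le_of_mem_convexHull _ w δQ (by rintro _ ⟨j, rfl⟩; exact hmax j) y (hQ hy)
  have hFG := h.face_add_face₁ w δP δQ hwP hwQ
  have hmaxpt : ∀ j, w ⬝ᵥ q j = δQ → q j = q j₀ := by
    intro j hj
    by_contra hne
    exact hwsep j j₀ hne (by rw [hj])
  have hQface : Q ∩ {y | w ⬝ᵥ y = δQ} ⊆ convexHull ℝ (Set.range fun _ : Fin 1 => q j₀) := by
    rintro y ⟨hy, hyw⟩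
    have hy' := mem_convexHull_maximisers q w δQ hmax (hQ hy) hyw
    have hsub : Set.range (fun j : {j : J // w ⬝ᵥ q j = δQ} => q j.1) ⊆ {q j₀} := by
      rintro _ ⟨j, rfl⟩; exact hmaxpt j.1 j.2
    have hy1 : y ∈ convexHull ℝ ({q j₀} : Set (Fin (n * n) → ℝ)) := convexHull_mono hsub hy'
    rw [convexHull_singleton] at hy1
    rw [Set.mem_singleton_iff.1 hy1]
    exact subset_convexHull ℝ _ ⟨0, rfl⟩
  -- (5) the unique-disjointness data of the face, indexed by subsets of `Fin m` (as in PROP B)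
  let B : Finset (Fin m) → Finset (Fin n) := fun b' => S ∪ b'.map e
  let A : Finset (Fin m) → Finset (Fin n) := fun a' => a'.map e
  have hAB : ∀ a' b', (A a' ∩ B b').card = (a' ∩ b').card := by
    intro a' b'
    have h1 : A a' ∩ B b' = (a' ∩ b').map e := by
      ext i
      simp only [A, B, Finset.mem_inter, Finset.mem_union, Finset.mem_map]
      constructor
      · rintro ⟨⟨x, hx, rfl⟩, h2 | ⟨y, hy, hxy⟩⟩
        · exact absurd h2 (heS x)
        · have hyx : y = x := e.injective hxy
          subst hyx
          exact ⟨y, ⟨hx, hy⟩, rfl⟩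
      · rintro ⟨x, ⟨hxa, hxb⟩, rfl⟩
        exact ⟨⟨x, hxa, rfl⟩, Or.inr ⟨x, hxb, rfl⟩⟩
    rw [h1, Finset.card_map]
  have hBface : ∀ b', S ⊆ B b' ∧ Disjoint S' (B b') := by
    intro b'
    refine ⟨Finset.subset_union_left, ?_⟩
    rw [Finset.disjoint_union_right]
    refine ⟨hSS'.symm, ?_⟩
    rw [Finset.disjoint_left]
    intro i hiS' hi
    obtain ⟨x, -, rfl⟩ := Finset.mem_map.1 hi
    exact heS' x hiS'
  have key := three_pow_le_of_add (α := Fin m) hFG (fun b' => udPt (B b'))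
    (fun b' => ⟨pt_mem _, hw_face _ (hBface b').1 (hBface b').2⟩) (fun a' => udRow (A a'))
    (fun _ => 1) (fun a' x hx => cc_valid (A a') x hx.1) ?_ ?_
    (fun _ : Fin 1 => q j₀) (fun _ => ⟨hq j₀, rfl⟩) hQface
  · simpa [Fintype.card_fin] using key
  · intro a' b' hlt hone
    have := slack (A a') (B b')
    rw [hAB, hone] at this
    norm_num at this
    linarith
  · intro a' b' hab
    have := slack (A a') (B b')
    rw [hAB, Finset.disjoint_iff_inter_eq_empty.1 hab, Finset.card_empty] at this
    norm_num at this
    linarith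

end LowDim

end Summit.ValiantsHypothesis.ValiantsHypothesis.Theorems.FifoMatching

end
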